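import Summits.AtomisticToContinuum.HydrodynamicLimit.Theses.AntiMazurCoboundaries
import Summits.AtomisticToContinuum.HydrodynamicLimit.Theorems.CellForecastPressureDecay.Negative.WithoutOrthogonality

/-!
# `stub_fixedOrderCumulantDecay` without orthogonality is false (negative lemma, drefute)

Crux `AntiMazurCoboundaries.CellForecastPressureDecay` (stmt-AtomisticToContinuum-13915), line
`tilt-analyticity-transfer` (`Cruxes/CellForecastPressureDecay/Lines/tilt-analyticity-transfer.lean`),
registered stub 3 `Holds.stub_fixedOrderCumulantDecay` (FIXED-ORDER CUMULANT DECAY): for every order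
`k` and tolerance `η`, eventually in the frame `T, R, L, n ≤ 2L³, Ψ`, every local normalised holomorphic
logarithm `q` of the complex tilt partition function `Z(c) = tiltZ n Ψ R T L g c`
(`exp (L³ q) = Z` near `0`, `q 0 = 0`) has `‖q^{(k)}(0)‖ ≤ η`.

MUTATION RESULT (hypothesis `g ⊥ span(1, v, |v|²)` DROPPED, everything else byte-identical, the line's
objects `cellLaw`, `windowAvg`, `tiltZ` copied verbatim since `Cruxes/…/Lines/*.lean` is not an importable
module): the mutated stub `StubFixedOrderCumulantDecayWithoutOrthogonality` is FALSE —
`stub_fixedOrderCumulantDecay_false_without_orthogonality`. Witness: `g ≡ κ` (continuous, `|g| ≤ κ`),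
order `k = 1`, `η = κ`; the window average of a constant along ANY forecast is `κ`, the cell law is a
probability measure (landed `isProbabilityMeasure_cellLaw`, σ ≤ 3/16, L ≥ 1, n ≤ 2L³), so
`Z(c) = exp (2κ n c)` EXACTLY, the entire function `q(c) = (2κn/L³)·c` is a normalised logarithm on
the unit tilt disc, and `q'(0) = 2κn/L³ > κ` for `n = ⌊L³⌋`, `L ≥ 2`. So orthogonality (to the
constants) is CONSUMED by stub 3 already at order `k = 1` — consistent with the line card, and the
stub-level twin of the landed crux-level lemma `cellForecastPressureDecay_false_without_orthogonality`.
(Stub 1 `stub_siteSummableLabelCumulants`, by contrast, holds for `g ≡ κ`: constant labels have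
vanishing joint cumulants of order ≥ 2 — paper remark, not formalised here.) [folklore]
-/

open MeasureTheory Set Metric Filter ProbabilityTheory Topology
open scoped ENNReal BigOperators
open Literature.Analysis.FluidPDE Literature.MathematicalPhysics.KineticTheory

namespace Summit.AtomisticToContinuum.HydrodynamicLimit.Theorems

noncomputable section

namespace CellForecastPressureDecay

namespace TiltAnalyticityTransfer

/-- Families of Euclidean hard-sphere flows in `ℝ³` with diameter `σ` (the crux's `Ψ`; copy of the
line's `Flows`). -/
abbrev Flows (σ : ℝ) : Type := (k : ℕ) → HardSphereFlow (Euclidean.geometry (Fin 3)) σ k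

/-- The canonical cell Gibbs law `P_{n,L}` of the crux (copy of the line's `cellLaw`, verbatim). -/
def cellLaw (σ : ℝ) (n : ℕ) (L : ℝ) (Φ : HardSphereFlow (Euclidean.geometry (Fin 3)) σ n) :
    Measure (Config n (Fin 3) V3) :=
  particleLaw Φ (canonicalDensity (Euclidean.geometry (Fin 3)) σ n
    (fun p => Set.indicator {x : V3 | ∀ k, x k ∈ Set.Icc (0 : ℝ) L} (fun _ => (1 : ℝ)) p.1 *
      globalMaxwellian p.2))

/-- The window average `aᵢ(z) = T⁻¹ ∫₀ᵀ g(v^{fc}_i(t)) dt` (copy of the line's `windowAvg`, verbatim). -/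
def windowAvg {σ : ℝ} {n : ℕ} (Ψ : Flows σ) (R T : ℝ) (g : V3 → ℝ) (z : Config n (Fin 3) V3)
    (i : Fin n) : ℝ :=
  T⁻¹ * ∫ t in (0 : ℝ)..T, g (localClusterState Ψ R t z i).2

/-- The complex tilt partition function `Z(c) = ∫ exp(2c Σᵢ aᵢ) dP_{n,L}` (copy of the line's
`tiltZ`, verbatim). -/
def tiltZ {σ : ℝ} (n : ℕ) (Ψ : Flows σ) (R T L : ℝ) (g : V3 → ℝ) (c : ℂ) : ℂ :=
  ∫ z, Complex.exp (2 * c * ((∑ i : Fin n, windowAvg Ψ R T g z i : ℝ) : ℂ)) ∂(cellLaw σ n L (Ψ n))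

/-- `Holds.stub_fixedOrderCumulantDecay` of line `tilt-analyticity-transfer` with the orthogonality
hypothesis `∀ c₀ c₂ b, ∫ g · (c₀ + ⟪b, v⟫ + c₂‖v‖²) dγ = 0` DROPPED (everything else byte-identical). -/
def StubFixedOrderCumulantDecayWithoutOrthogonality : Prop :=
    ∃ σ₀ : ℝ, 0 < σ₀ ∧ ∀ σ : ℝ, 0 < σ → σ < σ₀ → ∃ κ : ℝ, 0 < κ ∧ ∀ g : V3 → ℝ, Continuous g →
      (∀ v, |g v| ≤ κ) →
      ∀ k : ℕ, ∀ η : ℝ, 0 < η → ∃ T₀ : ℝ, 0 < T₀ ∧ ∀ T : ℝ, T₀ ≤ T → ∃ R₀ : ℝ, 0 < R₀ ∧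
        ∀ R : ℝ, R₀ ≤ R → ∃ L₀ : ℝ, 0 < L₀ ∧ ∀ L : ℝ, L₀ ≤ L → ∀ n : ℕ, (n : ℝ) ≤ 2 * L ^ 3 →
          ∀ Ψ : (k : ℕ) → HardSphereFlow (Euclidean.geometry (Fin 3)) σ k,
            ∀ r : ℝ, 0 < r → ∀ q : ℂ → ℂ, DifferentiableOn ℂ q (ball 0 r) → q 0 = 0 →
              (∀ c : ℂ, ‖c‖ < r → Complex.exp ((L : ℂ) ^ 3 * q c) = tiltZ n Ψ R T L g c) →
              ‖iteratedDeriv k q 0‖ ≤ η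

/-- For a constant observable the window average along any forecast is the constant (`T ≠ 0`). [folklore] -/
theorem windowAvg_const {σ : ℝ} {n : ℕ} (Ψ : Flows σ) (R : ℝ) {T : ℝ} (hT : T ≠ 0) (κ : ℝ)
    (z : Config n (Fin 3) V3) (i : Fin n) : windowAvg Ψ R T (fun _ => κ) z i = κ := by
  simp only [windowAvg, intervalIntegral.integral_const, sub_zero, smul_eq_mul,
    inv_mul_cancel_left₀ hT]

/-- For `g ≡ κ` and a probability cell law, `Z(c) = exp (2 c n κ)` exactly. [folklore] -/
theorem tiltZ_const {σ : ℝ} (n : ℕ) (Ψ : Flows σ) (R : ℝ) {T : ℝ} (hT : T ≠ 0) (L κ : ℝ)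
    [IsProbabilityMeasure (cellLaw σ n L (Ψ n))] (c : ℂ) :
    tiltZ n Ψ R T L (fun _ => κ) c = Complex.exp (2 * c * ((n * κ : ℝ) : ℂ)) := by
  simp only [tiltZ, windowAvg_const Ψ R hT κ, Finset.sum_const, Finset.card_univ,
    Fintype.card_fin, nsmul_eq_mul, integral_const, probReal_univ, one_smul]

/-- **Stub 3 of `tilt-analyticity-transfer` needs orthogonality (to the constants) at order 1.**
With `g ≡ κ`, `k = 1`, `η = κ`: `Z(c) = e^{2κnc}`, `q(c) = (2κn/L³) c` is an admissible normalised
logarithm on the unit tilt disc, and `‖q'(0)‖ = 2κn/L³ > κ` for `n = ⌊L³⌋`, `L ≥ 2`. [folklore] -/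
theorem stub_fixedOrderCumulantDecay_false_without_orthogonality :
    ¬ StubFixedOrderCumulantDecayWithoutOrthogonality := by
  rintro ⟨σ₀, hσ₀, h⟩
  set σ : ℝ := min (σ₀ / 2) (3 / 16) with hσdef
  have hσpos : 0 < σ := by positivity
  have hσlt : σ < σ₀ := (min_le_left _ _).trans_lt (by linarith)
  obtain ⟨κ, hκ, h⟩ := h σ hσpos hσlt
  obtain ⟨T₀, hT₀, h⟩ :=
    h (fun _ => κ) continuous_const (fun v => by rw [abs_of_pos hκ]) 1 κ hκ
  obtain ⟨R₀, hR₀, h⟩ := h T₀ le_rfl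
  obtain ⟨L₀, hL₀, h⟩ := h R₀ le_rfl
  set L : ℝ := max L₀ 2 with hLdef
  have hL2 : 2 ≤ L := le_max_right _ _
  have hLpos : 0 < L := by linarith
  have hL3pos : 0 < L ^ 3 := pow_pos hLpos 3
  set n : ℕ := ⌊L ^ 3⌋₊ with hndef
  have hnle : (n : ℝ) ≤ L ^ 3 := Nat.floor_le hL3pos.le
  have hnlt : L ^ 3 < n + 1 := Nat.lt_floor_add_one _
  have hn2 : (n : ℝ) ≤ 2 * L ^ 3 := by linarith
  set Ψ : (k : ℕ) → HardSphereFlow (Euclidean.geometry (Fin 3)) σ k :=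
    fun k => (HardSphereFlow.nonempty_holds hσpos k).some with hΨ
  -- the cell law is a probability measure (landed Negative lemma)
  haveI hP : IsProbabilityMeasure (cellLaw σ n L (Ψ n)) :=
    isProbabilityMeasure_cellLaw (min_le_right _ _) (by linarith) hn2 (Ψ n)
  -- the explicit normalised logarithm
  set A : ℝ := 2 * κ * n / L ^ 3 with hA
  have hA0 : 0 ≤ A := by positivity
  set q : ℂ → ℂ := fun c => (A : ℂ) * c with hq
  have hqd : DifferentiableOn ℂ q (ball 0 1) := fun c _ =>
    ((differentiableAt_id.const_mul (A : ℂ)).differentiableWithinAt)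
  have hq0 : q 0 = 0 := by simp [hq]
  have hqZ : ∀ c : ℂ, ‖c‖ < 1 → Complex.exp ((L : ℂ) ^ 3 * q c) = tiltZ n Ψ R₀ T₀ L (fun _ => κ) c := by
    intro c _
    rw [tiltZ_const n Ψ R₀ hT₀.ne' L κ c]
    congr 1
    simp only [hq, hA]
    have hLc : (L : ℂ) ≠ 0 := Complex.ofReal_ne_zero.2 hLpos.ne'
    push_cast
    field_simp
  have key := h L (le_max_left _ _) n hn2 Ψ 1 one_pos q hqd hq0 hqZ
  -- ‖q'(0)‖ = A
  have hderiv : iteratedDeriv 1 q 0 = (A : ℂ) := by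
    rw [iteratedDeriv_one]
    have : HasDerivAt q ((A : ℂ) * 1) 0 := (hasDerivAt_id (0 : ℂ)).const_mul (A : ℂ)
    rw [mul_one] at this
    exact this.deriv
  rw [hderiv, Complex.norm_real, Real.norm_eq_abs, abs_of_nonneg hA0, hA] at key
  -- key : 2 * κ * n / L ^ 3 ≤ κ, but 2 n > L ^ 3
  rw [div_le_iff₀ hL3pos] at key
  have h8 : (8 : ℝ) ≤ L ^ 3 := by
    have h4 : (4 : ℝ) ≤ L ^ 2 := by nlinarith
    nlinarith
  nlinarith [mul_pos hκ (by linarith : (0 : ℝ) < 2 * n - L ^ 3)]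

end TiltAnalyticityTransfer

end CellForecastPressureDecay

end

end Summit.AtomisticToContinuum.HydrodynamicLimit.Theorems
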